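import Literature.MathematicalPhysics.QuantumFieldTheory.Balaban1983to89.Node00.CriticalOnFibre
import Literature.MathematicalPhysics.QuantumFieldTheory.Balaban1983to89.B14Eq16FaddeevPopov
import HarnessLib

/-!
# K0⁷ STUB 1 (`stub_prop8StepCoP13`), sub-target S4a — **CRITICALITY ON A MULTI-LEVEL (0.4) FIBRE IS GAUGE-COVARIANT**: `Node00.IsCritOnFibre F N K 𝔹 W U` for a level-bounded
# determining set `𝔹` transports along every fine `SU(N)` gauge transformation `u` to `IsCritOnFibre F N K 𝔹 (u↑ • W) (u • U)` (`u↑_j = u ∘ embIter j` the block-centre tower)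
# — input (i) of the socket producers (dag-n07-w1 p632841, this seat's `…K0Stub1FlatChartCriticalityTransfer`) at a GAUGE COPY of the record's minimiser (the Landau ∕ axial
# copy `U₁ = e^{iηA₁}` of the K0 road §1–§3), file 6 of this seat's g7 bricks

Cell `pub-ymgap`, width seat `pub-ymgap-k0-s1-w1` g7 (CLAIM-5).  `--kind proof --supports stmt-QuantumFields-20541 --as helper`; count-neutral.  [15] = [Balaban1985Variational];
[B7AVG] = [Balaban1985Averaging]; [III] = [Balaban1988Convergent]; [I] = [Balaban1987RG1].

WHY.  Both socket spines consume `hcrit : IsCritOnFibre F N K 𝔹 W (charted base point)`; the record delivers criticality at its MINIMISER `U₀` (`Node00.isCritOnFibre_of_isMinimizer_classTop`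
and kin), while the charted base point is a gauge copy `U₁ = U₀^{u}` ([15] (152)–(153): the Landau copy; n07-w6's axial-tower representative).  The curve form of criticality is
covariant under fine gauge transformations for the plain reason that (a) `γ ↦ u⁻¹ • γ` maps bondwise-differentiable curves through `u • U` to such curves through `U` (constant matrix
factors), (b) the averaging of record is EXACTLY covariant level by level (`Setup.Averaging.covariant` iterated: `T4Continuum.iter_gaugeAct`, block-centre tower `transfUp`), so
`AgreeOn 𝔹` with the transported datum is equivalent, and (c) `𝔄(u⁻¹ • γ t) = 𝔄(γ t)` (lit ✓`B14Eq16FaddeevPopov.wilsonAction4_gaugeAct'`).  Level-boundedness of `𝔹`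
(`𝔹 j = ∅` above the standing range `m + K`) is needed because `Averaging.covariant` is stated in the standing range only.

WHAT IS PROVED (sorry-free; no definition; axioms standard; `F : T4Family`, `P = F.P K`, `N ≥ 1`).
* §1 `transfUp_inv` (`(u⁻¹)↑_j = (u↑_j)⁻¹`; `u⁻¹ • (u • U) = U` is the tree's `RegionalVP.gaugeAct_inv_gaugeAct` ∕ UST `gaugeAct_inv_gaugeAct_self`, inlined), `coe_gaugeAct_apply'`
  (the matrix of a transformed bond variable), `differentiableAt_coe_gaugeAct_const` (a constant gauge transformation preserves bondwise differentiability of a curve),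
  `agreeOn_gaugeAct_iff` (`AgreeOn 𝔹 (avgFamily av (u • V)) (u↑ • W) ↔ AgreeOn 𝔹 (avgFamily av V) W`, level-bounded `𝔹`).
* §2 ★★★ `isCritOnFibre_gaugeAct` (`IsCritOnFibre … 𝔹 W U → IsCritOnFibre … 𝔹 (u↑ • W) (u • U)`), ★★ `isCritOnFibre_gaugeAct_iff`, and ★★★ `isCritOnFibre_gaugeAct_avgFamily_iff` — with the
  point's OWN averages as datum: `IsCritOnFibre … 𝔹 (avgFamily av (u • U)) (u • U) ↔ IsCritOnFibre … 𝔹 (avgFamily av U) U`.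
HONEST SCOPE.  Bookkeeping over `Setup`'s covariance field and the gauge invariance of `𝔄`; no estimate; `stub_prop8StepCoP13` ∕ K0⁷ NOT closed; N07 NOT discharged; counts unmoved
(28∕28 · 5∕27); R4 closes the conditional finite-𝕋⁴ rung `BalabanLadder.UV` only; the YM mass gap (Clay) is NOT proved by any of this; nothing continuum ∕ ℝ⁴ ∕ OS.  No `sorry`, no
`def`, no `instance`, no `notation`.

References: [15] T. Bałaban, CMP **102** (1985) 277–309 ((5)–(6) p.278, (152)–(153) p.301); [B7AVG] CMP **98** (1985) 17–51 ((8), (11)–(13) p.19); [III] CMP **119** (1988)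
243–285 ((0.2) p.244, (2.10)–(2.12) p.256); [I] CMP **109** (1987) 249–301 ((0.11) p.253).
-/

set_option autoImplicit false

noncomputable section

open scoped Matrix.Norms.L2Operator Topology
open Filter

namespace Summit.QuantumFields.YangMills.Theorems.K0Stub1CritOnFibreGaugeCovariance

open Literature.MathematicalPhysics.QuantumFieldTheory.Balaban1983to89
open T4Continuum
open B15DeterminingSets (avgFamily bondsOf DetSet AgreeOn MSField)
open Node00 (avOfRecord IsCritOnFibre)

variable {P : Params} {G : Type*} [GaugeGroup G]

/-! ## §1  Bookkeeping -/

/-- the block-centre tower of the inverse transformation is the inverse of the tower. [cite: Balaban1985Averaging, (11) p.19] -/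
theorem transfUp_inv (u : GaugeTransf P 0 G) : ∀ (j : ℕ) (y : Site P j), transfUp (fun x => (u x)⁻¹) j y = (transfUp u j y)⁻¹
  | 0, _ => rfl
  | j + 1, y => transfUp_inv u j (emb y)

variable {N : ℕ} [NeZero N]

/-- the matrix of a gauge-transformed `SU(N)` bond variable. [cite: Balaban1985Averaging, (8) p.19] -/
theorem coe_gaugeAct_apply' {j : ℕ} (u : GaugeTransf P j (Matrix.specialUnitaryGroup (Fin N) ℂ)) (U : GaugeField P j (Matrix.specialUnitaryGroup (Fin N) ℂ)) (b : PBond P j) :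
    ((GaugeField.gaugeAct u U b : Matrix.specialUnitaryGroup (Fin N) ℂ) : Matrix (Fin N) (Fin N) ℂ) =
      ((u b.src : Matrix.specialUnitaryGroup (Fin N) ℂ) : Matrix (Fin N) (Fin N) ℂ) * ((U b : Matrix.specialUnitaryGroup (Fin N) ℂ) : Matrix (Fin N) (Fin N) ℂ) *
        (((u b.tgt)⁻¹ : Matrix.specialUnitaryGroup (Fin N) ℂ) : Matrix (Fin N) (Fin N) ℂ) := rfl

/-- a CONSTANT gauge transformation preserves bondwise differentiability of a curve of `SU(N)` fields. [cite: Balaban1985Averaging, (8) p.19] -/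
theorem differentiableAt_coe_gaugeAct_const {j : ℕ} (u : GaugeTransf P j (Matrix.specialUnitaryGroup (Fin N) ℂ)) {γ : ℝ → GaugeField P j (Matrix.specialUnitaryGroup (Fin N) ℂ)} {t₀ : ℝ}
    (hγ : DifferentiableAt ℝ (fun (t : ℝ) (b : PBond P j) => ((γ t b : Matrix.specialUnitaryGroup (Fin N) ℂ) : Matrix (Fin N) (Fin N) ℂ)) t₀) :
    DifferentiableAt ℝ (fun (t : ℝ) (b : PBond P j) => ((GaugeField.gaugeAct u (γ t) b : Matrix.specialUnitaryGroup (Fin N) ℂ) : Matrix (Fin N) (Fin N) ℂ)) t₀ := by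
  refine differentiableAt_pi.2 fun b => ?_
  have hb : DifferentiableAt ℝ (fun t : ℝ => ((γ t b : Matrix.specialUnitaryGroup (Fin N) ℂ) : Matrix (Fin N) (Fin N) ℂ)) t₀ := differentiableAt_pi.1 hγ b
  have e : (fun t : ℝ => ((GaugeField.gaugeAct u (γ t) b : Matrix.specialUnitaryGroup (Fin N) ℂ) : Matrix (Fin N) (Fin N) ℂ)) = fun t =>
      ((u b.src : Matrix.specialUnitaryGroup (Fin N) ℂ) : Matrix (Fin N) (Fin N) ℂ) * ((γ t b : Matrix.specialUnitaryGroup (Fin N) ℂ) : Matrix (Fin N) (Fin N) ℂ) *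
        (((u b.tgt)⁻¹ : Matrix.specialUnitaryGroup (Fin N) ℂ) : Matrix (Fin N) (Fin N) ℂ) := funext fun t => coe_gaugeAct_apply' u (γ t) b
  rw [e]
  exact ((differentiableAt_const _).mul hb).mul (differentiableAt_const _)

section T4

open T4Continuum (T4Family)

variable (F : T4Family) (K : ℕ)

/-- **THE FIBRE CONDITION IS COVARIANT** (level-bounded `𝔹`): `AgreeOn 𝔹 (avgFamily av (u • V)) (u↑ • W) ↔ AgreeOn 𝔹 (avgFamily av V) W`, `av` the averaging of record,
`u↑_j = transfUp u j` — `Setup.Averaging.covariant` iterated (`T4Continuum.iter_gaugeAct`) in the standing range, where all of `𝔹` lives.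
[cite: Balaban1985Averaging, (11)-(13) p.19; Balaban1988Convergent, (2.10) p.256] -/
theorem agreeOn_gaugeAct_iff {𝔹 : DetSet (F.P K)} (h𝔹 : ∀ j, (F.P K).m + (F.P K).K < j → 𝔹 j = ∅) (u : GaugeTransf (F.P K) 0 (Matrix.specialUnitaryGroup (Fin N) ℂ))
    (V : GaugeField (F.P K) 0 (Matrix.specialUnitaryGroup (Fin N) ℂ)) (W : MSField (F.P K) (Matrix.specialUnitaryGroup (Fin N) ℂ)) :
    AgreeOn 𝔹 (avgFamily (avOfRecord F N K) (GaugeField.gaugeAct u V)) (fun j => GaugeField.gaugeAct (transfUp u j) (W j)) ↔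
      AgreeOn 𝔹 (avgFamily (avOfRecord F N K) V) W := by
  -- every bond of `𝔹` lives in the standing range
  have hlev : ∀ (j : ℕ) (b : PBond (F.P K) j), b ∈ bondsOf (𝔹 j) → j ≤ (F.P K).m + (F.P K).K := by
    intro j b hb
    by_contra hlt
    have he : 𝔹 j = ∅ := h𝔹 j (not_le.mp hlt)
    rcases hb with h | h <;> rw [he] at h <;> exact h
  have hcov : ∀ j, j ≤ (F.P K).m + (F.P K).K →
      avgFamily (avOfRecord F N K) (GaugeField.gaugeAct u V) j = GaugeField.gaugeAct (transfUp u j) (avgFamily (avOfRecord F N K) V j) :=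
    fun j hj => iter_gaugeAct (avOfRecord F N K) u j hj V
  constructor
  · intro h j b hb
    have hj := hlev j b hb
    have h1 := h j b hb
    rw [hcov j hj] at h1
    -- cancel the transformation at `b`
    simp only [GaugeField.gaugeAct] at h1
    exact mul_left_cancel (mul_right_cancel h1)
  · intro h j b hb
    have hj := hlev j b hb
    rw [hcov j hj]
    show (transfUp u j b.src) * avgFamily (avOfRecord F N K) V j b * (transfUp u j b.tgt)⁻¹ = (transfUp u j b.src) * W j b * (transfUp u j b.tgt)⁻¹
    rw [h j b hb]

/-! ## §2  Criticality is gauge-covariant -/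

/-- ★★★ **CRITICALITY ON THE FIBRE IS GAUGE-COVARIANT**: for a level-bounded determining set `𝔹`, `IsCritOnFibre F N K 𝔹 W U` implies
`IsCritOnFibre F N K 𝔹 (u↑ • W) (u • U)` for every fine `SU(N)` gauge transformation `u` — pull a curve `γ` through `u • U` in the transported fibre back by `u⁻¹`: it is a
bondwise-differentiable curve through `U` in the original fibre with the same action. [cite: Balaban1985Variational, (5)-(6) p.278, (152)-(153) p.301; Balaban1985Averaging, (11)-(13) p.19; Balaban1988Convergent, (0.2) p.244, (2.10)-(2.12) p.256] -/
theorem isCritOnFibre_gaugeAct {𝔹 : DetSet (F.P K)} (h𝔹 : ∀ j, (F.P K).m + (F.P K).K < j → 𝔹 j = ∅)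
    {W : MSField (F.P K) (Matrix.specialUnitaryGroup (Fin N) ℂ)} {U : GaugeField (F.P K) 0 (Matrix.specialUnitaryGroup (Fin N) ℂ)}
    (u : GaugeTransf (F.P K) 0 (Matrix.specialUnitaryGroup (Fin N) ℂ)) (h : IsCritOnFibre F N K 𝔹 W U) :
    IsCritOnFibre F N K 𝔹 (fun j => GaugeField.gaugeAct (transfUp u j) (W j)) (GaugeField.gaugeAct u U) := by
  intro γ hγ0 hγd hγfib a ha
  -- the pulled-back curve
  let γ' : ℝ → GaugeField (F.P K) 0 (Matrix.specialUnitaryGroup (Fin N) ℂ) := fun t => GaugeField.gaugeAct (fun x => (u x)⁻¹) (γ t)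
  have hγ'0 : γ' 0 = U := by
    show GaugeField.gaugeAct (fun x => (u x)⁻¹) (γ 0) = U
    rw [hγ0]; funext b; simp [GaugeField.gaugeAct, mul_assoc]
  have hγ'd : DifferentiableAt ℝ (fun (t : ℝ) (b : PBond (F.P K) 0) => ((γ' t b : Matrix.specialUnitaryGroup (Fin N) ℂ) : Matrix (Fin N) (Fin N) ℂ)) 0 :=
    differentiableAt_coe_gaugeAct_const (fun x => (u x)⁻¹) hγd
  have hγ'fib : ∀ᶠ t in 𝓝 (0 : ℝ), AgreeOn 𝔹 (avgFamily (avOfRecord F N K) (γ' t)) W := by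
    filter_upwards [hγfib] with t ht
    have e : γ t = GaugeField.gaugeAct u (γ' t) := by
      funext b; simp [γ', GaugeField.gaugeAct, mul_assoc]
    rw [e] at ht
    exact (agreeOn_gaugeAct_iff F K h𝔹 u (γ' t) W).1 ht
  have hA : (fun t => wilsonAction4 (γ' t)) = fun t => wilsonAction4 (γ t) :=
    funext fun t => B14Eq16FaddeevPopov.wilsonAction4_gaugeAct' (fun x => (u x)⁻¹) (γ t)
  exact h γ' hγ'0 hγ'd hγ'fib a (by rw [hA]; exact ha)

/-- ★★ **… AND CONVERSELY** (apply the previous lemma to `u⁻¹`). [cite: Balaban1985Variational, (5)-(6) p.278; Balaban1985Averaging, (11)-(13) p.19] -/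
theorem isCritOnFibre_gaugeAct_iff {𝔹 : DetSet (F.P K)} (h𝔹 : ∀ j, (F.P K).m + (F.P K).K < j → 𝔹 j = ∅)
    (W : MSField (F.P K) (Matrix.specialUnitaryGroup (Fin N) ℂ)) (U : GaugeField (F.P K) 0 (Matrix.specialUnitaryGroup (Fin N) ℂ))
    (u : GaugeTransf (F.P K) 0 (Matrix.specialUnitaryGroup (Fin N) ℂ)) :
    IsCritOnFibre F N K 𝔹 (fun j => GaugeField.gaugeAct (transfUp u j) (W j)) (GaugeField.gaugeAct u U) ↔ IsCritOnFibre F N K 𝔹 W U := by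
  refine ⟨fun h => ?_, isCritOnFibre_gaugeAct F K h𝔹 u⟩
  have h' := isCritOnFibre_gaugeAct F K h𝔹 (fun x => (u x)⁻¹) h
  have hW : (fun j => GaugeField.gaugeAct (transfUp (fun x => (u x)⁻¹) j) (GaugeField.gaugeAct (transfUp u j) (W j))) = W := by
    funext j
    have e : transfUp (fun x => (u x)⁻¹) j = fun y => (transfUp u j y)⁻¹ := funext (transfUp_inv u j)
    rw [e]; funext b; simp [GaugeField.gaugeAct, mul_assoc]
  have hU : GaugeField.gaugeAct (fun x => (u x)⁻¹) (GaugeField.gaugeAct u U) = U := by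
    funext b; simp [GaugeField.gaugeAct, mul_assoc]
  rwa [hW, hU] at h'

/-- ★★★ **WITH THE POINT's OWN AVERAGES AS DATUM**: `IsCritOnFibre F N K 𝔹 (avgFamily av (u • U)) (u • U) ↔ IsCritOnFibre F N K 𝔹 (avgFamily av U) U` (level-bounded `𝔹`) — the
form in which the socket producers take input (i) at a gauge copy (Landau ∕ axial) of the record's minimiser.
[cite: Balaban1985Variational, (5)-(6) p.278, (152)-(153) p.301; Balaban1985Averaging, (11)-(13) p.19; Balaban1988Convergent, (2.10)-(2.12) p.256] -/
theorem isCritOnFibre_gaugeAct_avgFamily_iff {𝔹 : DetSet (F.P K)} (h𝔹 : ∀ j, (F.P K).m + (F.P K).K < j → 𝔹 j = ∅)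
    (U : GaugeField (F.P K) 0 (Matrix.specialUnitaryGroup (Fin N) ℂ)) (u : GaugeTransf (F.P K) 0 (Matrix.specialUnitaryGroup (Fin N) ℂ)) :
    IsCritOnFibre F N K 𝔹 (avgFamily (avOfRecord F N K) (GaugeField.gaugeAct u U)) (GaugeField.gaugeAct u U) ↔
      IsCritOnFibre F N K 𝔹 (avgFamily (avOfRecord F N K) U) U := by
  -- the fibre of `avgFamily av (u • U)` and of the transported datum `u↑ • avgFamily av U` have the same curves (they agree on the standing range)
  have hfib : ∀ V : GaugeField (F.P K) 0 (Matrix.specialUnitaryGroup (Fin N) ℂ),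
      AgreeOn 𝔹 (avgFamily (avOfRecord F N K) V) (avgFamily (avOfRecord F N K) (GaugeField.gaugeAct u U)) ↔
        AgreeOn 𝔹 (avgFamily (avOfRecord F N K) V) (fun j => GaugeField.gaugeAct (transfUp u j) (avgFamily (avOfRecord F N K) U j)) := by
    intro V
    have hlev : ∀ (j : ℕ) (b : PBond (F.P K) j), b ∈ bondsOf (𝔹 j) → j ≤ (F.P K).m + (F.P K).K := by
      intro j b hb
      by_contra hlt
      have he : 𝔹 j = ∅ := h𝔹 j (not_le.mp hlt)
      rcases hb with h | h <;> rw [he] at h <;> exact h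
    refine ⟨fun h j b hb => ?_, fun h j b hb => ?_⟩
    · rw [h j b hb]; exact congrFun (iter_gaugeAct (avOfRecord F N K) u j (hlev j b hb) U) b
    · rw [h j b hb]; exact (congrFun (iter_gaugeAct (avOfRecord F N K) u j (hlev j b hb) U) b).symm
  have hequiv : IsCritOnFibre F N K 𝔹 (avgFamily (avOfRecord F N K) (GaugeField.gaugeAct u U)) (GaugeField.gaugeAct u U) ↔
      IsCritOnFibre F N K 𝔹 (fun j => GaugeField.gaugeAct (transfUp u j) (avgFamily (avOfRecord F N K) U j)) (GaugeField.gaugeAct u U) := by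
    refine ⟨fun h γ hγ0 hγd hγf => h γ hγ0 hγd (hγf.mono fun t ht => (hfib (γ t)).2 ht),
      fun h γ hγ0 hγd hγf => h γ hγ0 hγd (hγf.mono fun t ht => (hfib (γ t)).1 ht)⟩
  rw [hequiv]
  exact isCritOnFibre_gaugeAct_iff F K h𝔹 (avgFamily (avOfRecord F N K) U) U u

end T4

end Summit.QuantumFields.YangMills.Theorems.K0Stub1CritOnFibreGaugeCovariance

end
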